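import Literature.Analysis.FunctionSpaces.Minlos
import Literature.Analysis.FunctionSpaces.MinlosProofs
import HarnessLib

/-!
# Minlos' theorem, Borel form: proofs

Discharges of the three "Borel" named facts of `Literature/Analysis/FunctionSpaces/Minlos.lean`:

* `Literature.Analysis.FunctionSpaces.borel_eq_dualCylinderSigma_holds` — on the weak-* dual `V' = V →Lₚₜ[ℝ] ℝ` of a
  *separable, first countable* topological vector space the Borel σ-algebra of the weak-*
  topology is the cylinder σ-algebra (generated by the evaluations); proved here without any
  nuclearity or local convexity (`Literature.Analysis.FunctionSpaces.borel_eq_dualCylinderSigma_of_separableSpace`);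
* `Literature.Analysis.FunctionSpaces.ext_of_genFunctionalOf_holds` — uniqueness of a finite Borel measure on `V'` with given
  generating functional (from the cylinder-σ-algebra uniqueness `Literature.Analysis.FunctionSpaces.ext_of_genFunctionalOf_eq`
  of `MinlosProofs`);
* `Literature.Analysis.FunctionSpaces.minlos_borel_holds` — Minlos' theorem for Borel probability measures on the dual of a
  separable Fréchet nuclear space (from `Literature.Analysis.FunctionSpaces.minlos_holds` of `MinlosProofs`).

## Proof of `borel = cylinder` (classical; Fernique 1967, Ch. III; cf. Gel'fand–Vilenkin IV, Ch. IV §1)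

Let `(Uₙ)` be a countable basis of open neighbourhoods of `0` in `V` and `(uᵢ)` a dense sequence.
Every `ω ∈ V'` is bounded by `1` on some `Uₙ`, so `V' = ⋃ₙ Kₙ` with the polars
`Kₙ = {ω | ∀ f ∈ Uₙ, |ω f| ≤ 1} = {ω | ∀ i, uᵢ ∈ Uₙ → |ω uᵢ| ≤ 1}` (density of `(uᵢ)` in the
open set `Uₙ` and continuity of `ω`), a cylinder-measurable set. The family `Kₙ` is
equicontinuous: if `(3/ε) v ∈ Uₙ` then `|ω v| ≤ ε/3` for all `ω ∈ Kₙ`. Hence, for a weak-* open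
`O` and `ω₀ ∈ O ∩ Kₙ`, a basic weak-* neighbourhood `{ω | ∀ f ∈ S, |ω f - ω₀ f| < ε} ⊆ O`
(`S` finite) contains `Kₙ ∩ B` for the *rational evaluation box*
`B = {ω | ∀ f ∈ S, ω u_{i(f)} ∈ (a_f, b_f)}`, where `u_{i(f)}` approximates `f` within
`(ε/3)·Uₙ` and `a_f < ω₀ u_{i(f)} < b_f` are rationals `ε/6`-close to `ω₀ u_{i(f)}`. There are
countably many such boxes, each cylinder-measurable, so `O = ⋃ₙ ⋃_{B, B ∩ Kₙ ⊆ O} (B ∩ Kₙ)` is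
cylinder-measurable. This is the classical argument that the weak-* dual of a separable
metrisable space is a countable union of metrisable (for the topology of pointwise convergence on
a countable dense set) equicontinuous pieces (Fernique 1967, Ch. III: duals of separable Fréchet
spaces are Lusin spaces; cf. Gel'fand–Vilenkin IV, Ch. IV §1 on cylinder sets).

## References

* I. M. Gel'fand, N. Ya. Vilenkin, *Generalized Functions IV* (1964), Ch. IV §1 (cylinder sets),
  §4.1–§4.2 (characteristic functionals; Minlos' theorem, §4.2 Thm 2).
* X. Fernique, *Processus linéaires, processus généralisés*, Ann. Inst. Fourier 17 (1967), Ch. III.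
* Y. Yamasaki, *Measures on infinite dimensional spaces* (1985), Part A §16, §20.
-/

open scoped NNReal Topology
open MeasureTheory Filter TopologicalSpace Set

namespace Literature.Analysis.FunctionSpaces

section BorelCylinder

variable {V : Type*} [AddCommGroup V] [Module ℝ V] [TopologicalSpace V]
  [IsTopologicalAddGroup V] [ContinuousSMul ℝ V]

omit [IsTopologicalAddGroup V] [ContinuousSMul ℝ V] in
/-- The polar-type set `{ω | ∀ f ∈ U, |ω f| ≤ 1}` of an *open* set `U ⊆ V` is measurable for the
cylinder σ-algebra as soon as a sequence `u` is dense in `V`: by continuity of `ω` it equals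
`⋂ {i | u i ∈ U}, {ω | |ω (u i)| ≤ 1}`. [folklore] -/
theorem measurableSet_polar_dualCylinderSigma {u : ℕ → V} (hu : DenseRange u) {U : Set V}
    (hU : IsOpen U) :
    MeasurableSet[dualCylinderSigma V] {ω : V →Lₚₜ[ℝ] ℝ | ∀ f ∈ U, |ω f| ≤ 1} := by
  letI : MeasurableSpace (V →Lₚₜ[ℝ] ℝ) := dualCylinderSigma V
  have heq : {ω : V →Lₚₜ[ℝ] ℝ | ∀ f ∈ U, |ω f| ≤ 1} =
      ⋂ i ∈ {i : ℕ | u i ∈ U}, {ω : V →Lₚₜ[ℝ] ℝ | |ω (u i)| ≤ 1} := by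
    ext ω
    simp only [mem_setOf_eq, mem_iInter]
    refine ⟨fun h i hi => h (u i) hi, fun h f hf => ?_⟩
    have hcl : f ∈ closure (U ∩ range u) := hu.open_subset_closure_inter hU hf
    have hclosed : IsClosed {g : V | |ω g| ≤ 1} :=
      isClosed_le (continuous_abs.comp ω.continuous) continuous_const
    have hsub : U ∩ range u ⊆ {g : V | |ω g| ≤ 1} := by
      rintro _ ⟨hgU, i, rfl⟩
      exact h i hgU
    exact hclosed.closure_subset_iff.2 hsub hcl
  rw [heq]
  refine MeasurableSet.biInter (Set.to_countable _) fun i _ => ?_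
  exact measurableSet_le ((measurable_eval_dualCylinderSigma (u i)).abs) measurable_const

omit [IsTopologicalAddGroup V] [ContinuousSMul ℝ V] in
/-- A *rational evaluation box*: `{ω | ∀ (i, a, b) ∈ L, ω (u i) ∈ (a, b)}` for a finite list of
indices and rational endpoints; measurable for the cylinder σ-algebra. [folklore] -/
theorem measurableSet_evalBox_dualCylinderSigma (u : ℕ → V) (L : Finset (ℕ × ℚ × ℚ)) :
    MeasurableSet[dualCylinderSigma V]
      {ω : V →Lₚₜ[ℝ] ℝ | ∀ t ∈ L, ω (u t.1) ∈ Ioo ((t.2.1 : ℚ) : ℝ) ((t.2.2 : ℚ) : ℝ)} := by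
  letI : MeasurableSpace (V →Lₚₜ[ℝ] ℝ) := dualCylinderSigma V
  have heq : {ω : V →Lₚₜ[ℝ] ℝ | ∀ t ∈ L, ω (u t.1) ∈ Ioo ((t.2.1 : ℚ) : ℝ) ((t.2.2 : ℚ) : ℝ)} =
      ⋂ t ∈ (L : Set (ℕ × ℚ × ℚ)),
        {ω : V →Lₚₜ[ℝ] ℝ | ω (u t.1) ∈ Ioo ((t.2.1 : ℚ) : ℝ) ((t.2.2 : ℚ) : ℝ)} := by
    ext ω
    simp
  rw [heq]
  refine MeasurableSet.biInter (L : Set (ℕ × ℚ × ℚ)).to_countable fun t _ => ?_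
  exact measurable_eval_dualCylinderSigma (u t.1) measurableSet_Ioo

variable (V) in
/-- **Borel = cylinder on the weak-* dual of a separable metrisable TVS.** If `V` is a first
countable, separable topological vector space, the Borel σ-algebra of the weak-* topology on
`V' = V →Lₚₜ[ℝ] ℝ` is generated by the evaluations `ω ↦ ω f`. (The dual is the countable union of
the equicontinuous polars `Kₙ` of a neighbourhood basis `Uₙ` of `0`; on `Kₙ` weak-* neighbourhoods
are controlled by evaluations at a dense sequence, so every weak-* open set is a countable union
of sets `B ∩ Kₙ`, `B` a rational evaluation box.) Fernique 1967, Ch. III (duals of separable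
Fréchet spaces are Lusin, Borel = cylinder σ-algebra); cf. Gel'fand–Vilenkin IV, Ch. IV §1.
[cite: Fernique1967, Ch. III] -/
theorem borel_eq_dualCylinderSigma_of_separableSpace [FirstCountableTopology V]
    [SeparableSpace V] : borel (V →Lₚₜ[ℝ] ℝ) = dualCylinderSigma V := by
  refine le_antisymm ?_ (dualCylinderSigma_le_borel V)
  letI : MeasurableSpace (V →Lₚₜ[ℝ] ℝ) := dualCylinderSigma V
  -- a dense sequence and a countable open neighbourhood basis of `0`
  obtain ⟨u, hu⟩ := TopologicalSpace.exists_dense_seq V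
  have hud : Dense (range u) := hu
  obtain ⟨x, hx⟩ := (𝓝 (0 : V)).exists_antitone_basis
  set U : ℕ → Set V := fun n => interior (x n) with hU_def
  have hUo : ∀ n, IsOpen (U n) := fun n => isOpen_interior
  have hUn : ∀ n, U n ∈ 𝓝 (0 : V) := fun n => interior_mem_nhds.2 (hx.1.mem_of_mem trivial)
  -- the polars
  set K : ℕ → Set (V →Lₚₜ[ℝ] ℝ) := fun n => {ω | ∀ f ∈ U n, |ω f| ≤ 1} with hK_def
  have hKm : ∀ n, MeasurableSet[dualCylinderSigma V] (K n) := fun n =>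
    measurableSet_polar_dualCylinderSigma hu (hUo n)
  have hKcov : ∀ ω : V →Lₚₜ[ℝ] ℝ, ∃ n, ω ∈ K n := by
    intro ω
    have h1 : (fun f : V => ω f) ⁻¹' Ioo (-1 : ℝ) 1 ∈ 𝓝 (0 : V) := by
      refine ω.continuous.continuousAt.preimage_mem_nhds ?_
      rw [map_zero]
      exact Ioo_mem_nhds (by norm_num) (by norm_num)
    obtain ⟨n, -, hn⟩ := hx.1.mem_iff.1 h1
    refine ⟨n, fun f hf => ?_⟩
    have := hn (interior_subset hf)
    exact abs_le.2 ⟨this.1.le, this.2.le⟩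
  -- equicontinuity of the polars
  have hKeq : ∀ n (ω : V →Lₚₜ[ℝ] ℝ), ω ∈ K n → ∀ {ε : ℝ}, 0 < ε → ∀ v : V,
      (3 / ε) • v ∈ U n → |ω v| ≤ ε / 3 := by
    intro n ω hω ε hε v hv
    have h1 := hω _ hv
    rw [map_smul, smul_eq_mul, abs_mul, abs_of_pos (by positivity)] at h1
    have h2 : |ω v| = (ε / 3) * ((3 / ε) * |ω v|) := by field_simp
    rw [h2]
    calc (ε / 3) * ((3 / ε) * |ω v|) ≤ (ε / 3) * 1 := by gcongr
      _ = ε / 3 := mul_one _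
  -- rational evaluation boxes
  set box : Finset (ℕ × ℚ × ℚ) → Set (V →Lₚₜ[ℝ] ℝ) := fun L =>
    {ω | ∀ t ∈ L, ω (u t.1) ∈ Ioo ((t.2.1 : ℚ) : ℝ) ((t.2.2 : ℚ) : ℝ)} with hbox_def
  have hboxm : ∀ L, MeasurableSet[dualCylinderSigma V] (box L) := fun L =>
    measurableSet_evalBox_dualCylinderSigma u L
  -- main lemma: inside `K n`, weak-* open sets are unions of boxes
  have hmain : ∀ (O : Set (V →Lₚₜ[ℝ] ℝ)), IsOpen O → ∀ n, ∀ ω₀ ∈ O ∩ K n,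
      ∃ L, ω₀ ∈ box L ∧ box L ∩ K n ⊆ O := by
    intro O hO n ω₀ hω₀
    obtain ⟨T, hT, hTO⟩ := (PointwiseConvergenceCLM.isEmbedding_coeFn (RingHom.id ℝ) V ℝ)
      |>.isInducing.isOpen_iff.1 hO
    have hω₀T : (⇑ω₀ : V → ℝ) ∈ T := by
      rw [← hTO] at hω₀
      exact hω₀.1
    obtain ⟨I, w, hw, hIT⟩ := isOpen_pi_iff.1 hT _ hω₀T
    -- a common radius `ε`
    have hε' : ∀ f ∈ I, ∃ ε > (0 : ℝ), Ioo (ω₀ f - ε) (ω₀ f + ε) ⊆ w f := by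
      intro f hf
      obtain ⟨ho, hmem⟩ := hw f hf
      obtain ⟨ε, hε, hball⟩ := Metric.isOpen_iff.1 ho _ hmem
      refine ⟨ε, hε, fun y hy => hball ?_⟩
      rw [Metric.mem_ball, Real.dist_eq, abs_lt]
      constructor <;> linarith [hy.1, hy.2]
    classical
    obtain ⟨ε, hε, hεw⟩ : ∃ ε > (0 : ℝ), ∀ f ∈ I, Ioo (ω₀ f - ε) (ω₀ f + ε) ⊆ w f := by
      rcases I.eq_empty_or_nonempty with hI | hI
      · exact ⟨1, one_pos, by simp [hI]⟩
      choose! e he hew using hε'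
      refine ⟨I.inf' hI e, (Finset.lt_inf'_iff hI).2 fun f hf => he f hf, fun f hf y hy => ?_⟩
      have hle : I.inf' hI e ≤ e f := Finset.inf'_le e hf
      exact hew f hf ⟨by linarith [hy.1], by linarith [hy.2]⟩
    -- approximate each `f ∈ I` by some `u (i f)` within `(ε/3) • U n`
    have happrox : ∀ f : V, ∃ i : ℕ, (3 / ε) • (f - u i) ∈ U n := by
      intro f
      have hcont : Continuous fun d : V => (3 / ε) • (f - d) := by fun_prop
      have hnhds : (fun d : V => (3 / ε) • (f - d)) ⁻¹' U n ∈ 𝓝 f := by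
        refine hcont.continuousAt.preimage_mem_nhds ?_
        simpa using hUn n
      obtain ⟨_, ⟨i, rfl⟩, hd⟩ := hud.inter_nhds_nonempty hnhds
      exact ⟨i, hd⟩
    choose i hi using happrox
    -- rational endpoints
    have hrat : ∀ f : V, ∃ ab : ℚ × ℚ, ω₀ (u (i f)) - ε / 6 < ab.1 ∧ (ab.1 : ℝ) < ω₀ (u (i f)) ∧
        ω₀ (u (i f)) < ab.2 ∧ (ab.2 : ℝ) < ω₀ (u (i f)) + ε / 6 := by
      intro f
      obtain ⟨a, ha1, ha2⟩ := exists_rat_btwn (show ω₀ (u (i f)) - ε / 6 < ω₀ (u (i f)) by linarith)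
      obtain ⟨b, hb1, hb2⟩ := exists_rat_btwn (show ω₀ (u (i f)) < ω₀ (u (i f)) + ε / 6 by linarith)
      exact ⟨(a, b), ha1, ha2, hb1, hb2⟩
    choose ab hab using hrat
    refine ⟨I.image fun f => (i f, ab f), ?_, ?_⟩
    · intro t ht
      obtain ⟨f, hf, rfl⟩ := Finset.mem_image.1 ht
      exact ⟨(hab f).2.1, (hab f).2.2.1⟩
    · rintro ω ⟨hωbox, hωK⟩
      rw [← hTO]
      refine hIT fun f hf => hεw f hf ?_
      have hf' : (i f, ab f) ∈ I.image fun f => (i f, ab f) := Finset.mem_image_of_mem _ hf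
      have h1 := hωbox _ hf'
      simp only [mem_Ioo] at h1
      have h2 : |ω (f - u (i f))| ≤ ε / 3 := hKeq n ω hωK hε _ (hi f)
      have h3 : |ω₀ (f - u (i f))| ≤ ε / 3 := hKeq n ω₀ hω₀.2 hε _ (hi f)
      rw [map_sub] at h2 h3
      have h4 := hab f
      rw [abs_le] at h2 h3
      constructor <;> linarith [h1.1, h1.2, h2.1, h2.2, h3.1, h3.2, h4.1, h4.2.2.2]
  -- conclusion
  refine MeasurableSpace.generateFrom_le fun O (hO : IsOpen O) => ?_
  have hrepr : O = ⋃ n, ⋃ (L : Finset (ℕ × ℚ × ℚ)) (_ : box L ∩ K n ⊆ O), box L ∩ K n := by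
    refine Subset.antisymm (fun ω hω => ?_) ?_
    · obtain ⟨n, hn⟩ := hKcov ω
      obtain ⟨L, hL, hLO⟩ := hmain O hO n ω ⟨hω, hn⟩
      exact mem_iUnion.2 ⟨n, mem_iUnion.2 ⟨L, mem_iUnion.2 ⟨hLO, hL, hn⟩⟩⟩
    · exact iUnion_subset fun n => iUnion_subset fun L => iUnion_subset fun h => h
  rw [hrepr]
  exact MeasurableSet.iUnion fun n => MeasurableSet.iUnion fun L =>
    MeasurableSet.iUnion fun _ => (hboxm L).inter (hKm n)

variable (V) in
/-- Discharge of the named fact `Literature.Analysis.FunctionSpaces.borel_eq_dualCylinderSigma`: for a separable Fréchet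
nuclear space (indeed for any separable first countable TVS,
`borel_eq_dualCylinderSigma_of_separableSpace`) the Borel σ-algebra of the weak-* dual is the
cylinder σ-algebra. Fernique 1967, Ch. III. [cite: Fernique1967, Ch. III] -/
theorem borel_eq_dualCylinderSigma_holds : borel_eq_dualCylinderSigma V := by
  intro _ _ _ _
  exact borel_eq_dualCylinderSigma_of_separableSpace V

/-- Discharge of the named fact `Literature.Analysis.FunctionSpaces.ext_of_genFunctionalOf` (uniqueness in Minlos' theorem,
Borel form): two finite Borel measures on the weak-* dual of a separable Fréchet nuclear space
with the same generating functional coincide — Borel = cylinder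
(`borel_eq_dualCylinderSigma_of_separableSpace`) and uniqueness on the cylinder σ-algebra
(`ext_of_genFunctionalOf_eq`). Gel'fand–Vilenkin IV, Ch. IV §4.1; Yamasaki 1985, Part A §16
Thm 16.2. [cite: GelfandVilenkinIV1964, Ch. IV §4.1] -/
theorem ext_of_genFunctionalOf_holds : ext_of_genFunctionalOf (V := V) := by
  intro _ _ _ _ _ _ μ ν _ _ h
  have hm : ‹MeasurableSpace (V →Lₚₜ[ℝ] ℝ)› = dualCylinderSigma V :=
    (BorelSpace.measurable_eq (α := V →Lₚₜ[ℝ] ℝ)).trans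
      (borel_eq_dualCylinderSigma_of_separableSpace V)
  exact ext_of_genFunctionalOf_eq hm fun f => congrFun h f

variable (V) in
/-- Discharge of the named fact `Literature.Analysis.FunctionSpaces.minlos_borel` (**Minlos' theorem, Borel form**): on the
weak-* dual of a separable Fréchet nuclear space `V`, every characteristic functional is the
generating functional of a unique Borel probability measure. From `minlos_holds` (cylinder
σ-algebra; Minlos 1959, Gel'fand–Vilenkin IV Ch. IV §4.2 Thm 2, Yamasaki 1985 Thm 20.1 (a)) and
Borel = cylinder (`borel_eq_dualCylinderSigma_of_separableSpace`).
[cite: GelfandVilenkinIV1964, Ch. IV §4.2 Thm. 2] [cite: Yamasaki1985, Part A §20, Thm 20.1 (a)]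
[cite: Fernique1967, Ch. III] -/
theorem minlos_borel_holds : minlos_borel V := by
  intro m _ _ _ _ _ C hC
  have hm : m = dualCylinderSigma V :=
    (BorelSpace.measurable_eq (α := V →Lₚₜ[ℝ] ℝ)).trans
      (borel_eq_dualCylinderSigma_of_separableSpace V)
  subst hm
  exact minlos_holds V C hC

end BorelCylinder

end Literature.Analysis.FunctionSpaces
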